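import Literature.MathematicalPhysics.QuantumLattice.InterClusterKernelIdentification
import HarnessLib

/-!
# The functional calculus through an intertwiner: locality of Kato's reduced resolvent on
# invariant subspaces

Topic `MathematicalPhysics/QuantumLattice`; continues `ClusterPairBosonCouplings.lean`
(`reducedResolvent H E = cfc (x ↦ (x − E)⁻¹) H`, Kato's reduced resolvent) and
`InterClusterKernelIdentification.lean` (`kroneckerSum`, the pair resolvent as the reduced resolvent of a
Kronecker sum). The reduction of Kato's second-order kernel `T S(E₀) T` of a MANY-cluster system (the
checkerboard Hubbard torus, `H₀ = Σ_R H_R`) to the two-cluster kernel rests on one linear-algebra fact: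
a subspace carried by a linear map `W : ℂⁿ → ℂᴺ` on which `H` acts as a (shifted) smaller Hermitian
matrix, `H W = W (H_loc + c)`, is invariant under every function of `H`, and there the function of `H`
IS the function of `H_loc + c`:

* `mulVec_smul_eigenvector_of_intertwine_shift` — `W` maps eigenvectors of `H_loc` to eigenvectors of `H`
  with eigenvalue shifted by `c`;
* `cfc_mulVec_of_intertwine_shift` — `f(H) (W v) = W (f(· + c))(H_loc) v` for every real `f` (no isometry or
  injectivity assumption on `W`; proof: expand `v` in an eigenbasis of `H_loc` and use
  `Matrix.IsHermitian.cfc_mulVec_of_eigenvector` on both sides);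
* `cfc_mulVec_of_intertwine` — the unshifted case `H W = W H_loc`;
* `reducedResolvent_mulVec_of_intertwine_shift` — **LOCALITY OF THE REDUCED RESOLVENT**:
  `S_H(E) (W v) = W (S_{H_loc}(E − c) v)`: on the subspace, Kato's reduced resolvent of the big system at
  `E` is that of the local Hamiltonian at the local energy `E − c` (the environment energy `c` subtracted);
* `eigenProj_mulVec_of_intertwine_shift` — the same for the eigenprojections.

Typical use (plaquette-boson dictionary, Tsai–Kivelson 2006 App. A): `H = Σ_R jwEmbed_R H_plaq` on the torus
Fock space, `W (a ⊗ b) =` the product state with plaquettes `R₁, R₂` in `a, b` and every other plaquette in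
its ground state, `H_loc = kroneckerSum H_plaq H_plaq`, `c = Σ_{R ≠ R₁,R₂} E_R`.

Mathlib / tree search: Mathlib has `cfc_comp` / `cfcHom` naturality for star-algebra HOMOMORPHISMS
(`StarAlgHom.map_cfc`), not for a bare intertwiner between different matrix sizes; tree:
`Matrix.IsHermitian.cfc_mulVec_of_eigenvector` (`TorusPairSusceptibility`),
`eq_sum_dotProduct_eigenvectorBasis_smul`, `mulVec_eigenvectorBasis_coe`
(`InterClusterKernelIdentification`, `SpectralProjectionDerivProofs`), `reducedResolvent`, `eigenProj`
(`ClusterPairBosonCouplings`). `lean search 'intertwin|cfc_mulVec_of'`: only the eigenvector lemma.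

References: T. Kato, *Perturbation theory for linear operators* (1966), I-§5.3 (5.26)–(5.32) (the reduced
resolvent and the eigenprojections as functions of the operator; reduction to invariant subspaces, I-§5.1)
[Kato1966]; W.-F. Tsai, S. A. Kivelson, PRB 73 (2006) 214510, App. A (A1) [TsaiKivelson2006].
-/

noncomputable section

namespace Literature.MathematicalPhysics.QuantumLattice

open Matrix

section Intertwine

variable {N n : Type*} [Fintype N] [DecidableEq N] [Fintype n] [DecidableEq n]
  {H : Matrix N N ℂ} {Hloc : Matrix n n ℂ}

omit [DecidableEq N] [DecidableEq n] in
/-- An intertwiner `H W = W H_loc + c W` maps an eigenvector of `H_loc` with eigenvalue `λ` to an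
eigenvector of `H` with eigenvalue `λ + c` (or to `0`). [cite: Kato1966, I-§5.1] -/
theorem mulVec_smul_eigenvector_of_intertwine_shift {W : Matrix N n ℂ} {c : ℝ}
    (hW : H * W = W * Hloc + (c : ℂ) • W) {u : n → ℂ} {lam : ℝ} (hu : Hloc *ᵥ u = (lam : ℂ) • u) :
    H *ᵥ (W *ᵥ u) = ((lam + c : ℝ) : ℂ) • (W *ᵥ u) := by
  rw [mulVec_mulVec, hW, add_mulVec, smul_mulVec, ← mulVec_mulVec, hu, mulVec_smul,
    ← add_smul, Complex.ofReal_add]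

/-- **The functional calculus through a (shifted) intertwiner.** If `H W = W H_loc + c W` for Hermitian
`H` (big) and `H_loc` (small) and a real shift `c`, then for every real function `f` and every vector `v`,
`f(H) (W v) = W ((x ↦ f (x + c))(H_loc) v)`: the range of `W` is invariant under `f(H)`, on which `f(H)`
acts as `f(H_loc + c)`. No injectivity of `W` is needed. [cite: Kato1966, I-§5.1 and I-§5.3 (5.26)–(5.32)] -/
theorem cfc_mulVec_of_intertwine_shift (hH : H.IsHermitian) (hL : Hloc.IsHermitian) {W : Matrix N n ℂ}
    {c : ℝ} (hW : H * W = W * Hloc + (c : ℂ) • W) (f : ℝ → ℝ) (v : n → ℂ) :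
    cfc f H *ᵥ (W *ᵥ v) = W *ᵥ (cfc (fun x => f (x + c)) Hloc *ᵥ v) := by
  -- expand `v` in an eigenbasis of `H_loc`
  conv_lhs => rw [eq_sum_dotProduct_eigenvectorBasis_smul hL v]
  conv_rhs => rw [eq_sum_dotProduct_eigenvectorBasis_smul hL v]
  simp only [mulVec_sum, mulVec_smul]
  refine Finset.sum_congr rfl fun μ _ => ?_
  have hu := mulVec_eigenvectorBasis_coe hL μ
  rw [hH.cfc_mulVec_of_eigenvector f (mulVec_smul_eigenvector_of_intertwine_shift hW hu),
    hL.cfc_mulVec_of_eigenvector (fun x => f (x + c)) hu, mulVec_smul]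

/-- The unshifted case: `H W = W H_loc ⇒ f(H) (W v) = W (f(H_loc) v)`. [cite: Kato1966, I-§5.1] -/
theorem cfc_mulVec_of_intertwine (hH : H.IsHermitian) (hL : Hloc.IsHermitian) {W : Matrix N n ℂ}
    (hW : H * W = W * Hloc) (f : ℝ → ℝ) (v : n → ℂ) :
    cfc f H *ᵥ (W *ᵥ v) = W *ᵥ (cfc f Hloc *ᵥ v) := by
  have hW' : H * W = W * Hloc + ((0 : ℝ) : ℂ) • W := by rw [hW, Complex.ofReal_zero, zero_smul, add_zero]
  rw [cfc_mulVec_of_intertwine_shift hH hL hW' f v]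
  simp only [add_zero]

/-- **LOCALITY OF KATO'S REDUCED RESOLVENT.** If `H W = W H_loc + c W` then on the range of `W` the
reduced resolvent of `H` at `E` is the reduced resolvent of `H_loc` at the LOCAL energy `E − c`:
`S_H(E) (W v) = W (S_{H_loc}(E − c) v)` (the terms with `λ + c = E` are dropped on both sides, `0⁻¹ = 0`).
For `H = Σ_R H_R` on a product of clusters, `W` the insertion of two excited clusters into a product of
ground states and `c` the energy of the other clusters, this is the reduction of `T S(E₀) T` to the
two-cluster kernel. [cite: Kato1966, I-§5.3 (5.32)] -/
theorem reducedResolvent_mulVec_of_intertwine_shift (hH : H.IsHermitian) (hL : Hloc.IsHermitian)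
    {W : Matrix N n ℂ} {c : ℝ} (hW : H * W = W * Hloc + (c : ℂ) • W) (E : ℝ) (v : n → ℂ) :
    reducedResolvent H E *ᵥ (W *ᵥ v) = W *ᵥ (reducedResolvent Hloc (E - c) *ᵥ v) := by
  rw [reducedResolvent, reducedResolvent, cfc_mulVec_of_intertwine_shift hH hL hW]
  congr 3
  funext x
  rw [show x + c - E = x - (E - c) by ring]

/-- The unshifted case of the locality of the reduced resolvent: `H W = W H_loc ⇒ S_H(E) W = W S_{H_loc}(E)`.
[cite: Kato1966, I-§5.3 (5.32)] -/
theorem reducedResolvent_mulVec_of_intertwine (hH : H.IsHermitian) (hL : Hloc.IsHermitian)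
    {W : Matrix N n ℂ} (hW : H * W = W * Hloc) (E : ℝ) (v : n → ℂ) :
    reducedResolvent H E *ᵥ (W *ᵥ v) = W *ᵥ (reducedResolvent Hloc E *ᵥ v) := by
  rw [reducedResolvent, reducedResolvent, cfc_mulVec_of_intertwine hH hL hW]

/-- Locality of the eigenprojections: `H W = W H_loc + c W ⇒ P_H(E) (W v) = W (P_{H_loc}(E − c) v)`.
[cite: Kato1966, I-§5.3 (5.26)] -/
theorem eigenProj_mulVec_of_intertwine_shift (hH : H.IsHermitian) (hL : Hloc.IsHermitian)
    {W : Matrix N n ℂ} {c : ℝ} (hW : H * W = W * Hloc + (c : ℂ) • W) (E : ℝ) (v : n → ℂ) :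
    eigenProj H E *ᵥ (W *ᵥ v) = W *ᵥ (eigenProj Hloc (E - c) *ᵥ v) := by
  rw [eigenProj, eigenProj, cfc_mulVec_of_intertwine_shift hH hL hW]
  congr 3
  funext x
  by_cases hx : x = E - c
  · rw [if_pos hx, if_pos (by rw [hx]; ring)]
  · rw [if_neg hx, if_neg (fun h => hx (by linarith))]

/-- Matrix elements: `⟨W v', S_H(E) W v⟩ = ⟨v', (Wᴴ W) S_{H_loc}(E − c) v⟩`; for an isometric `W`
(`Wᴴ W = 1`) the big resolvent's matrix elements between vectors of the range ARE the local ones.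
[cite: Kato1966, I-§5.3 (5.32)] -/
theorem star_mulVec_dotProduct_reducedResolvent_mulVec_of_intertwine_shift (hH : H.IsHermitian)
    (hL : Hloc.IsHermitian) {W : Matrix N n ℂ} {c : ℝ} (hW : H * W = W * Hloc + (c : ℂ) • W)
    (hWW : Wᴴ * W = 1) (E : ℝ) (v' v : n → ℂ) :
    star (W *ᵥ v') ⬝ᵥ (reducedResolvent H E *ᵥ (W *ᵥ v)) =
      star v' ⬝ᵥ (reducedResolvent Hloc (E - c) *ᵥ v) := by
  rw [reducedResolvent_mulVec_of_intertwine_shift hH hL hW, star_mulVec, ← dotProduct_mulVec,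
    mulVec_mulVec, hWW, one_mulVec]

end Intertwine

end Literature.MathematicalPhysics.QuantumLattice

end
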